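import Literature.AlgebraicGeometry.HodgeTheory.WeilClassesSixfoldsProofs
import Literature.AlgebraicGeometry.Motives.AbelianVarietyCohomologyExteriorH1
import HarnessLib

/-!
# Route HeckePrymWeil · crux `WeilTenfoldsSqrtMinus11` (stmt-HodgeConjecture-1262) · line
# `quaternionic-norm-anchors` · stub 1 `stub_oneClassSuffices` — CLOSED, unconditional

"One class suffices" on a `ℚ(√-11)`-Weil abelian tenfold: if ONE non-zero rational class of the
Weil plane `weilClassesOf B ψ 5 11 = E₊ ⊕ E₋` is algebraic, then every rational `(5,5)`-class of the
plane is algebraic (Markman arXiv:2509.23079 p. 2: "it suffices to prove the algebraicity of one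
non-zero class in `HW(A, η)`, as `K` acts via algebraic correspondences"; van Geemen LNM 1594, proof of
Thm. 6.12). In the tree this is the Literature theorem
`weilClassesOf_le_algebraicClasses_iff_exists_ne_zero_of_dim_eq` (`WeilClassesSixfoldsProofs`:
the eigencomponents of an algebraic class are algebraic because the test isogenies `x·𝟙 + y·ψ` are
flat; complex conjugation swaps the two Weil LINES, `dim E± = 1`) fed with the freshly PROVED named
fact `Motives.abelianVarietyCohomologyExteriorH1_holds` (`H•(A(ℂ); ℂ) = ⋀•H¹`, Hopf). VERBATIM the
registered stub `stub_oneClassSuffices` of the skeleton `Lines/quaternionic-norm-anchors.lean`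
(lead c1 reshape, 2026-08-16).
-/

noncomputable section

-- single-problem summit (Problem = Summit): the mandated namespace repeats `HodgeConjecture`.
set_option linter.dupNamespace false

open CategoryTheory AlgebraicGeometry
open Literature.AlgebraicGeometry.Motives Literature.AlgebraicGeometry.HodgeTheory
open Literature.AlgebraicTopology.SingularHomology

namespace Summit.HodgeConjecture.HodgeConjecture.Theorems.HeckePrymWeil

/-- **Stub 1 `stub_oneClassSuffices`, CLOSED.** On a complex abelian tenfold `B` with `ψ ≫ ψ = -11`:
one non-zero rational algebraic class in `weilClassesOf B ψ 5 11` makes every rational `(5,5)` class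
of the Weil plane algebraic (`weilClassesOf_le_algebraicClasses_iff_exists_ne_zero_of_dim_eq` with
`abelianVarietyCohomologyExteriorH1_holds`; the rationality and Hodge-type hypotheses on `c` are not
even needed — the whole complexified plane is algebraic). -/
theorem stub_oneClassSuffices :
    ∀ (B : AbelianVariety ℂ) (ψ : B ⟶ B), B.dim = 10 → ψ ≫ ψ = -((11 : ℤ) • 𝟙 B) →
      (∃ u₁ : complexBetti B.X (2 * 5), IsRationalClass u₁ ∧ u₁ ∈ weilClassesOf B ψ 5 11 ∧ u₁ ≠ 0 ∧
        u₁ ∈ algebraicClasses B.X 5) →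
      ∀ c : complexBetti B.X (2 * 5), IsRationalClass c → IsOfHodgeType (2 * 5) B.X (2 * 5) 5 5 c →
        c ∈ weilClassesOf B ψ 5 11 → c ∈ algebraicClasses B.X 5 := by
  intro B ψ hB hψ hex c _ _ hcW
  obtain ⟨u₁, -, hu₁W, hu₁0, hu₁a⟩ := hex
  have hψ' : ψ ≫ ψ = -((11 : ℕ) • 𝟙 B) := by rw [hψ, ← natCast_zsmul]; rfl
  have hB' : B.dim = 2 * 5 := by rw [hB]
  exact (weilClassesOf_le_algebraicClasses_iff_exists_ne_zero_of_dim_eq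
    abelianVarietyCohomologyExteriorH1_holds hB' (by norm_num) (by norm_num) hψ').mpr
      ⟨u₁, hu₁W, hu₁a, hu₁0⟩ hcW

end Summit.HodgeConjecture.HodgeConjecture.Theorems.HeckePrymWeil

end
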